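import Mathlib.Tactic
import Literature.Computability.Complexity.Promise
import Literature.Computability.Cryptography.ClassBQP
import Summits.QuantumAdvantage.QuantumAdvantage.Statement
import HarnessLib

/-!
# SoloInformedPromiseSepIffSummit — under the lift hypothesis the summit IS the (weak) promise separation

Solo seat `solo-QuantumAdvantage-informed` (ideation tier, summit-directed); completes the picture of
`SoloInformedPseudoDeterministicLift` / `SoloInformedPromiseLiftPP`. With `Q-EXT := PromiseBQP ⊆ promiseLift BQP`
and the weak promise separation `PSep := ¬(PromiseBQP ⊆ promiseLift BPP)` ("some `PromiseBQP` problem is solved by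
no `BPP` language"; `PromiseBPP = promiseLift BPP` in the tree):

* `promiseSep_of_quantumAdvantage : QuantumAdvantage → PSep` — unconditionally, the summit implies the weak promise
  separation (a witness language `L ∈ BQP ∖ BPP` is, as a trivial-promise problem, solved only by itself);
* `quantumAdvantage_iff_promiseSep_of_promiseIsLift : Q-EXT → (QuantumAdvantage ↔ PSep)`.

So `PSep` is a NECESSARY condition for the summit which becomes SUFFICIENT exactly when the lift hypothesis holds;
by `SoloInformedPromiseLiftPP`, `Q-EXT` holds whenever `PP ⊆ BQP` and `PSep` fails whenever `PP ⊆ BPP`.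
[cite: Goldreich2006, Def. 1.2] [cite: Watrous2009, §III.2]
-/

noncomputable section

namespace Summit.QuantumAdvantage.QuantumAdvantage.Theorems

open _root_.Computability Literature.Computability.Complexity Literature.Computability.Cryptography

/-- **The summit implies the weak promise separation**: if `L ∈ BQP ∖ BPP` then the trivial-promise problem
`⟨L, Lᶜ⟩ ∈ PromiseBQP` is solved by no `BPP` language (its only solution is `L`). [cite: Goldreich2006, Def. 1.2] -/
theorem promiseSep_of_quantumAdvantage (h : QuantumAdvantage) : ¬ PromiseBQP ⊆ PromiseBPP := by
  obtain ⟨L, hL, hLB⟩ := h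
  intro hsub
  have h1 : PromiseProblem.ofLanguage L ∈ PromiseBQP := ofLanguage_mem_PromiseBQP_iff.2 hL
  have h2 : PromiseProblem.ofLanguage L ∈ promiseLift BPP := hsub h1
  exact hLB (ofLanguage_mem_promiseLift_iff.1 h2)

/-- **Under the lift hypothesis the summit is equivalent to the weak promise separation.**
[cite: Goldreich2006, Def. 1.2] -/
theorem quantumAdvantage_iff_promiseSep_of_promiseIsLift (hExt : PromiseBQP ⊆ promiseLift BQP) :
    QuantumAdvantage ↔ ¬ PromiseBQP ⊆ PromiseBPP := by
  refine ⟨promiseSep_of_quantumAdvantage, fun hSep => ?_⟩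
  by_contra hQA
  apply hSep
  refine hExt.trans (promiseLift_mono fun L hL => ?_)
  by_contra hLB
  exact hQA ⟨L, hL, hLB⟩

end Summit.QuantumAdvantage.QuantumAdvantage.Theorems

end
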